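import Summits.QuantumFields.YangMills.Theorems.VirialFluxGapSectorWeightSmooth
import HarnessLib

/-!
# `VirialIdentity` (item stmt-QuantumFields-24161, support of routes `VirialFluxGap` and `SwapVirialDeficit`): the seam-sector weights are
# positive and differentiable in the coupling, with derivative the `Φ_z`-inserted weight

`W_z(b) = TT.sectorWeight b n z 1 > 0` and `d/db W_z(b) = TT.sectorWeight b n z Φ_z`,
`Φ_z(Us, g) = Σ_{i<n} [timeCoupling(U_i,U_{i+1}) − ½(S(U_i)+S(U_{i+1}))] + [timeCoupling(U_n, g·tw_z U_0) − ½(S(U_n)+S(g·tw_z U_0))]` — the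
virial (mean-Φ) identity feeding `PeriodicSoftness` / `TwistedEquipartition` / `ToronSoftnessSharp` / `SwapGluedStiffness` (seat ym-idea-4, LINES
g14-A/B; = `stub_virial` of the birth skeletons on ⟨24141⟩/⟨24133⟩).

Mechanism: companion ✓`VirialFluxGapSectorWeightSmooth` (⟨24143⟩): `W_z(b) = ∫ e^{bΦ'_z}`, `Φ'_z = log(chain at b = 1)`, dominated differentiation
`hasDerivAt_integral_exp_mul` gives derivative `∫ Φ'_z e^{bΦ'_z}`; pointwise `Φ'_z = Φ_z` (`log K_1(U,V) = timeCoupling − ½(S+S)`, `log_seamChain_one`) and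
`e^{bΦ'_z} = chain_b`, so the derivative is the one-integral form (✓`sectorWeight_eq_integral_prod`) of `sectorWeight b n z Φ_z`.

HONEST FRAMING: an M support (calculus); no crux / rung / summit statement is proved; the YM mass gap is NOT proved (width seat ym-line-sfw-p2-w3 g35
of cell ym-idea-1, free hands).  THEOREMS ONLY (0 `def`, 0 `sorry`), standard axioms.  References: [cite: MontvayMunster1994, (3.145)]; [cite: Luscher1983, §2].
-/

set_option autoImplicit false

noncomputable section

open MeasureTheory Filter Set Function
open scoped BigOperators Topology
open Literature.MathematicalPhysics.QuantumFieldTheory hiding SU2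

namespace Summit.QuantumFields.YangMills.Theorems.FemtoTransferGap.TT.SectorSmooth

open Summit.QuantumFields.YangMills.Theorems.FemtoTransferGap
open Summit.QuantumFields.YangMills.Theorems.FemtoTransferGap.TT
open Summit.QuantumFields.YangMills.Theorems.FemtoTransferGap.TwoLattice.TowerA (measurable_seamWeight_uncurry)

variable {L : ℕ} [NeZero L]

/-- `log K_1(U,V) = timeCoupling(U,V) − ½(S(U) + S(V))`. [cite: Luscher1983, §2] -/
theorem log_transferKernel_one (U V : GaugeConfig 3 L SU2) :
    Real.log (transferKernel su2Rep 1 U V) =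
      timeCoupling su2Rep U V - (1 / 2 : ℝ) * (wilsonAction su2Rep U + wilsonAction su2Rep V) := by
  unfold transferKernel
  rw [Real.log_exp]
  ring

/-- The seam-closed chain at coupling `b` is the exponential tilt `exp(b · log(chain at 1))`. [folklore] -/
theorem seamChain_eq_exp (b : ℝ) (n : ℕ) (z : Fin 3 → Bool) (p : (Fin (n + 1) → GaugeConfig 3 L SU2) × (Site 3 L → SU2)) :
    (∏ i : Fin n, transferKernel su2Rep b (p.1 i.castSucc) (p.1 i.succ)) *
        transferKernel su2Rep b (p.1 (Fin.last n)) (gaugeTransform p.2 (twist3 z (p.1 0))) =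
      Real.exp (b * Real.log ((∏ i : Fin n, transferKernel su2Rep 1 (p.1 i.castSucc) (p.1 i.succ)) *
        transferKernel su2Rep 1 (p.1 (Fin.last n)) (gaugeTransform p.2 (twist3 z (p.1 0))))) := by
  rw [log_seamChain_one, mul_add, Real.exp_add, Finset.mul_sum, Real.exp_sum]
  congr 1
  · exact Finset.prod_congr rfl fun i _ => transferKernel_eq_exp_mul_log b _ _
  · exact transferKernel_eq_exp_mul_log b _ _

/-- The virial insertion `Φ_z` IS the exponent `log(chain at 1)`, pointwise. [folklore] -/
theorem virialInsertion_eq_log_seamChain_one (n : ℕ) (z : Fin 3 → Bool) (Us : Fin (n + 1) → GaugeConfig 3 L SU2) (g : Site 3 L → SU2) :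
    (∑ i : Fin n, (timeCoupling su2Rep (Us i.castSucc) (Us i.succ) -
        (1 / 2 : ℝ) * (wilsonAction su2Rep (Us i.castSucc) + wilsonAction su2Rep (Us i.succ)))) +
      (timeCoupling su2Rep (Us (Fin.last n)) (gaugeTransform g (twist3 z (Us 0))) -
        (1 / 2 : ℝ) * (wilsonAction su2Rep (Us (Fin.last n)) + wilsonAction su2Rep (gaugeTransform g (twist3 z (Us 0))))) =
    Real.log ((∏ i : Fin n, transferKernel su2Rep 1 (Us i.castSucc) (Us i.succ)) *
        transferKernel su2Rep 1 (Us (Fin.last n)) (gaugeTransform g (twist3 z (Us 0)))) := by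
  rw [log_seamChain_one n z (Us, g)]
  simp only [log_transferKernel_one]

/-- ★★ **THE VIRIAL IDENTITY** (statement shape of item stmt-QuantumFields-24161): `W_z(b) > 0` and
`HasDerivAt (b' ↦ W_z(b')) (sectorWeight b n z Φ_z) b`. [cite: MontvayMunster1994, (3.145)] [cite: Luscher1983, §2] -/
theorem sectorWeight_virial (n : ℕ) (z : Fin 3 → Bool) (b : ℝ) :
    0 < sectorWeight (L := L) b n z (fun _ _ => (1 : ℝ)) ∧
      HasDerivAt (fun b' : ℝ => sectorWeight (L := L) b' n z (fun _ _ => (1 : ℝ)))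
        (sectorWeight (L := L) b n z (fun Us g =>
          (∑ i : Fin n, (timeCoupling su2Rep (Us i.castSucc) (Us i.succ) -
              (1 / 2 : ℝ) * (wilsonAction su2Rep (Us i.castSucc) + wilsonAction su2Rep (Us i.succ)))) +
            (timeCoupling su2Rep (Us (Fin.last n)) (gaugeTransform g (twist3 z (Us 0))) -
              (1 / 2 : ℝ) * (wilsonAction su2Rep (Us (Fin.last n)) + wilsonAction su2Rep (gaugeTransform g (twist3 z (Us 0))))))) b := by
  haveI := isProbabilityMeasure_gaugeMeasure (L := L)
  refine ⟨sectorWeight_one_pos b n z, ?_⟩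
  obtain ⟨B, hB⟩ := exists_abs_sectorExponent_le (L := L) n z
  -- the insertion, as a function of (slices, seam field), is the exponent
  set Φ : (Fin (n + 1) → GaugeConfig 3 L SU2) → (Site 3 L → SU2) → ℝ := fun Us g =>
    (∑ i : Fin n, (timeCoupling su2Rep (Us i.castSucc) (Us i.succ) -
        (1 / 2 : ℝ) * (wilsonAction su2Rep (Us i.castSucc) + wilsonAction su2Rep (Us i.succ)))) +
      (timeCoupling su2Rep (Us (Fin.last n)) (gaugeTransform g (twist3 z (Us 0))) -
        (1 / 2 : ℝ) * (wilsonAction su2Rep (Us (Fin.last n)) + wilsonAction su2Rep (gaugeTransform g (twist3 z (Us 0))))) with hΦ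
  have hΦeq : uncurry Φ = fun p : (Fin (n + 1) → GaugeConfig 3 L SU2) × (Site 3 L → SU2) =>
      Real.log ((∏ i : Fin n, transferKernel su2Rep 1 (p.1 i.castSucc) (p.1 i.succ)) *
        transferKernel su2Rep 1 (p.1 (Fin.last n)) (gaugeTransform p.2 (twist3 z (p.1 0)))) := by
    funext p
    show Φ p.1 p.2 = _
    simp only [hΦ]
    exact virialInsertion_eq_log_seamChain_one n z p.1 p.2
  have hΦm : Measurable (uncurry Φ) := by
    rw [hΦeq]; exact (measurable_seamWeight_uncurry (L := L) 1 z n).log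
  have hΦb : ∀ Us g, |Φ Us g| ≤ B := fun Us g => by
    have h := hB (Us, g)
    rw [← virialInsertion_eq_log_seamChain_one n z Us g] at h
    exact h
  -- dominated differentiation of the exponential tilt
  have hder := hasDerivAt_integral_exp_mul ((Measure.pi fun _ : Fin (n + 1) => configMeasure SU2 L).prod (gaugeMeasure L))
    (measurable_sectorExponent (L := L) n z) hB b
  have hfun : (fun b' : ℝ => sectorWeight (L := L) b' n z (fun _ _ => (1 : ℝ))) =
      fun b' : ℝ => ∫ p : (Fin (n + 1) → GaugeConfig 3 L SU2) × (Site 3 L → SU2),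
        Real.exp (b' * Real.log ((∏ i : Fin n, transferKernel su2Rep 1 (p.1 i.castSucc) (p.1 i.succ)) *
          transferKernel su2Rep 1 (p.1 (Fin.last n)) (gaugeTransform p.2 (twist3 z (p.1 0)))))
        ∂((Measure.pi fun _ : Fin (n + 1) => configMeasure SU2 L).prod (gaugeMeasure L)) :=
    funext fun b' => sectorWeight_one_eq_integral_exp b' n z
  rw [hfun]
  -- the derivative is the `Φ_z`-inserted weight
  have hval : sectorWeight (L := L) b n z Φ =
      ∫ p : (Fin (n + 1) → GaugeConfig 3 L SU2) × (Site 3 L → SU2),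
        Real.log ((∏ i : Fin n, transferKernel su2Rep 1 (p.1 i.castSucc) (p.1 i.succ)) *
            transferKernel su2Rep 1 (p.1 (Fin.last n)) (gaugeTransform p.2 (twist3 z (p.1 0)))) *
          Real.exp (b * Real.log ((∏ i : Fin n, transferKernel su2Rep 1 (p.1 i.castSucc) (p.1 i.succ)) *
            transferKernel su2Rep 1 (p.1 (Fin.last n)) (gaugeTransform p.2 (twist3 z (p.1 0)))))
        ∂((Measure.pi fun _ : Fin (n + 1) => configMeasure SU2 L).prod (gaugeMeasure L)) := by
    rw [sectorWeight_eq_integral_prod b n z hΦm hΦb]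
    refine integral_congr_ae (ae_of_all _ fun p => ?_)
    dsimp only
    rw [seamChain_eq_exp b n z p, ← virialInsertion_eq_log_seamChain_one n z p.1 p.2]
    simp only [hΦ]
    ring
  rw [hval]
  exact hder

end Summit.QuantumFields.YangMills.Theorems.FemtoTransferGap.TT.SectorSmooth

/-! ## The item, by name -/

namespace Summit.QuantumFields.YangMills.Theorems

open Summit.QuantumFields.YangMills.Theorems.FemtoTransferGap.TT.SectorSmooth

/-- ★★ **`VirialIdentity` holds** (item stmt-QuantumFields-24161, ledger signature VERBATIM — the item is a support of routes `VirialFluxGap` and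
`SwapVirialDeficit` filed without a route-file declaration, so it is stated by its signature): positivity and the `b`-derivative of every
seam-sector weight, derivative = the `Φ_z`-inserted weight.  No crux / rung / summit is proved; the YM mass gap is NOT proved.
[cite: MontvayMunster1994, (3.145)] -/
theorem virialIdentity_proof :
    ∀ (L : ℕ) [NeZero L] (n : ℕ) (z : Fin 3 → Bool) (b : ℝ), 0 < Summit.QuantumFields.YangMills.Theorems.FemtoTransferGap.TT.sectorWeight (L := L) b n z (fun _ _ => (1 : ℝ)) ∧ HasDerivAt (fun b' : ℝ => Summit.QuantumFields.YangMills.Theorems.FemtoTransferGap.TT.sectorWeight (L := L) b' n z (fun _ _ => (1 : ℝ))) (Summit.QuantumFields.YangMills.Theorems.FemtoTransferGap.TT.sectorWeight (L := L) b n z (fun Us g => (∑ i : Fin n, (Summit.QuantumFields.YangMills.Theorems.FemtoTransferGap.timeCoupling Summit.QuantumFields.YangMills.Theorems.FemtoTransferGap.su2Rep (Us i.castSucc) (Us i.succ) - (1 / 2 : ℝ) * (Literature.MathematicalPhysics.QuantumFieldTheory.wilsonAction Summit.QuantumFields.YangMills.Theorems.FemtoTransferGap.su2Rep (Us i.castSucc)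 + Literature.MathematicalPhysics.QuantumFieldTheory.wilsonAction Summit.QuantumFields.YangMills.Theorems.FemtoTransferGap.su2Rep (Us i.succ)))) + (Summit.QuantumFields.YangMills.Theorems.FemtoTransferGap.timeCoupling Summit.QuantumFields.YangMills.Theorems.FemtoTransferGap.su2Rep (Us (Fin.last n)) (Literature.MathematicalPhysics.QuantumFieldTheory.gaugeTransform g (Summit.QuantumFields.YangMills.Theorems.FemtoTransferGap.TT.twist3 z (Us 0))) - (1 / 2 : ℝ) * (Literature.MathematicalPhysics.QuantumFieldTheory.wilsonAction Summit.QuantumFields.YangMills.Theorems.FemtoTransferGap.su2Rep (Us (Fin.last n)) + Literature.MathematicalPhysics.QuantumFieldTheory.wilsonAction Summit.QuantumFields.YangMills.Theorems.FemtoTransferGap.su2Rep (Literature.MathematicalPhysics.QuantumFieldTheory.gaugeTransform g (Summit.QuantumFields.YangMills.Theorems.FemtoTransferGap.TT.twist3 z (Us 0))))))) b := by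
  intro L _ n z b
  exact sectorWeight_virial n z b

end Summit.QuantumFields.YangMills.Theorems

end
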